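import Literature.Analysis.InverseSpectral.KreinStringSpectral
import Literature.Analysis.InverseSpectral.StieltjesInversion
import HarnessLib

/-!
# Kreĭn strings: the Weyl solution and its `L²(dm)` norm

For a Kreĭn string `S[m, L]` other than the free half-line and `z ∈ ℂ ∖ [0, ∞)` we study the
**Weyl solution** `ω(t, z) = q_S(z) φ(t, z) - ψ(t, z)` (the solution with `ω(0) = q_S(z)`,
`ω⁺'(0-) = -1`, which is subdominant at `L`):

* `weylSolution_eq`: `ω = φ · I` with the tail integral `I(t, z) = q_S(z) - ∫₀ᵗ φ(u,z)⁻² du`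
  (Tomisaki 1988 (4.1)), and `I(x, z) → 0` as `x → L` (`tendsto_tailInt`);
* `norm_tailInt_le`: the tail estimate `|I(x,z)| ≤ c⁻² (T(x) + M(x))⁻¹` from the energy method of
  `KreinStringWeylLimit`;
* `im_mul_integral_norm_weylSolution_sq`: Green's formula
  `Im z ∫_{[0,x]} |ω|² dm = Im q_S(z) - Im(ω⁺'(x) conj ω(x))`, and the vanishing of the boundary
  term as `x → L` (`tendsto_boundaryTerm`), whence the exact identity
  `Im z ∫_{[0,L)} |ω(·,z)|² dm = Im q_S(z)` (`integral_norm_weylSolution_sq`, Kac–Kreĭn 1974 §2,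
  (2.16)-type identity) and `ω(·, z) ∈ L²(dm)` (`memLp_weylSolution`).

Everything here is PROVED; no named facts.

## References

KacKrein1974 (§2), Tomisaki1988 (§4), DymMcKean1976 (§5.4).
-/

open MeasureTheory Filter Set Topology ComplexConjugate
open scoped ENNReal

noncomputable section

namespace Literature.Analysis.InverseSpectral

namespace KreinString

variable (S : KreinString)

/-! ### The Weyl solution and the tail integral -/

/-- The **Weyl solution** `ω(t, z) = q_S(z) φ(t, z) - ψ(t, z)`: the solution of the string equation
with `ω(0) = q_S(z)`, `ω⁺'(0-) = -1`; for `z ∉ [0, ∞)` it is the subdominant solution at `L`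
(`= φ · I`, `I → 0`). [cite: KacKrein1974, §2] -/
def weylSolution (z : ℂ) (t : ℝ) : ℂ := S.principalWeylFunction z * S.phi z t - S.psi z t

/-- The **tail integral** `I(t, z) = q_S(z) - ∫₀ᵗ φ(u, z)⁻² du` (`= ∫ₜᴸ φ⁻²` for `z ∉ [0, ∞)`).
[cite: Tomisaki1988, §4 (4.1)] -/
def tailInt (z : ℂ) (t : ℝ) : ℂ :=
  S.principalWeylFunction z - ∫ u in (0 : ℝ)..t, ((S.phi z u) ^ 2)⁻¹

/-- The right derivative of the Weyl solution, `ω⁺'(x) = -1 - z ∫_{[0,x]} ω dm`. [folklore] -/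
def weylDeriv (z : ℂ) (x : ℝ) : ℂ := -1 - z * ∫ u in Icc 0 x, S.weylSolution z u ∂S.massMeasure

/-- `ω` solves the string equation with data `(q_S(z), -1)`. [cite: KacKrein1974, §2] -/
theorem isSolution_weylSolution (z : ℂ) :
    S.IsSolution z (S.principalWeylFunction z) (-1) (S.weylSolution z) := by
  have h := (S.isSolution_phi z).lincomb (S.isSolution_psi z) (S.principalWeylFunction z) (-1)
  have hfun : (fun u => S.principalWeylFunction z * S.phi z u + -1 * S.psi z u) = S.weylSolution z :=
    funext fun u => by simp only [weylSolution]; ring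
  rw [hfun] at h
  simpa using h

/-- Continuity of `ω(·, z)` on `[0, L)`. [folklore] -/
theorem continuousOn_weylSolution (z : ℂ) : ContinuousOn (S.weylSolution z) S.dom :=
  (S.isSolution_weylSolution z).1

/-- `ω(0, z) = q_S(z)`. [folklore] -/
theorem weylSolution_zero (z : ℂ) : S.weylSolution z 0 = S.principalWeylFunction z := by
  simp [weylSolution, phi_apply_zero, psi_apply_zero]

/-- **`ω = φ · I`** on `[0, L)` for `z ∉ [0, ∞)`. [cite: Tomisaki1988, §4 (4.1)] -/
theorem weylSolution_eq {z : ℂ} (hz : z ∈ offNonnegAxis) {t : ℝ} (ht : t ∈ S.dom) :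
    S.weylSolution z t = S.phi z t * S.tailInt z t := by
  have hφ := S.phi_ne_zero_of_mem_offNonnegAxis hz ht
  have h := S.psi_div_phi_eq_integral_of_mem_offNonnegAxis hz ht
  rw [weylSolution, tailInt, ← h]
  field_simp

/-- **`I(x, z) → 0` as `x → L`.** [cite: KacKrein1974, §2] -/
theorem tendsto_tailInt (hS : ¬ S.IsTrivial) {z : ℂ} (hz : z ∈ offNonnegAxis) :
    Tendsto (S.tailInt z) S.toEnd (𝓝 0) := by
  have hq := S.tendsto_principalWeylFunction hS hz
  have hev : ∀ᶠ x in S.toEnd, S.psi z x / S.phi z x = ∫ u in (0 : ℝ)..x, ((S.phi z u) ^ 2)⁻¹ :=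
    Filter.eventually_of_mem (S.Ici_inter_dom_mem_toEnd S.zero_mem_dom) fun x hx =>
      S.psi_div_phi_eq_integral_of_mem_offNonnegAxis hz hx.1
  have h2 : Tendsto (fun x => ∫ u in (0 : ℝ)..x, ((S.phi z u) ^ 2)⁻¹) S.toEnd
      (𝓝 (S.principalWeylFunction z)) := hq.congr' hev
  have h3 := (tendsto_const_nhds (x := S.principalWeylFunction z)).sub h2
  rw [sub_self] at h3
  exact h3

/-- The Wronskian identity `ω⁺' = φ⁺' I - φ⁻¹` on `[0, L)` for `z ∉ [0, ∞)`. [folklore] -/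
theorem weylDeriv_eq {z : ℂ} (hz : z ∈ offNonnegAxis) {x : ℝ} (hx : x ∈ S.dom) :
    S.weylDeriv z x = (-z * ∫ u in Icc 0 x, S.phi z u ∂S.massMeasure) * S.tailInt z x -
      (S.phi z x)⁻¹ := by
  have hφ := S.phi_ne_zero_of_mem_offNonnegAxis hz hx
  have hW := S.wronskian_phi_psi z hx
  -- `∫ ω = q ∫ φ - ∫ ψ`
  have hφi : IntegrableOn (S.phi z) (Icc 0 x) S.massMeasure :=
    S.integrableOn_Icc_of_continuousOn hx ((S.isSolution_phi z).1.mono (S.Icc_subset_dom hx))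
  have hψi : IntegrableOn (S.psi z) (Icc 0 x) S.massMeasure :=
    S.integrableOn_Icc_of_continuousOn hx ((S.isSolution_psi z).1.mono (S.Icc_subset_dom hx))
  have hint : ∫ u in Icc 0 x, S.weylSolution z u ∂S.massMeasure =
      S.principalWeylFunction z * (∫ u in Icc 0 x, S.phi z u ∂S.massMeasure) -
        ∫ u in Icc 0 x, S.psi z u ∂S.massMeasure := by
    simp only [weylSolution]
    rw [integral_sub (hφi.const_mul _) hψi, integral_const_mul]
  -- `I = q - ψ/φ`
  have hI : S.tailInt z x = S.principalWeylFunction z - S.psi z x / S.phi z x := by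
    rw [tailInt, S.psi_div_phi_eq_integral_of_mem_offNonnegAxis hz hx]
  rw [weylDeriv, hint, hI, div_eq_mul_inv]
  have h3 : (S.phi z x)⁻¹ * S.phi z x = 1 := inv_mul_cancel₀ hφ
  linear_combination (-(S.phi z x)⁻¹) * hW +
    (1 - z * ∫ u in Icc 0 x, S.psi z u ∂S.massMeasure) * h3


/-! ### The tail estimate -/

/-- `φ(·, z)⁻²` is interval-integrable on `[0, x]`, `x ∈ [0, L)`, for `z ∉ [0, ∞)`. [folklore] -/
lemma intervalIntegrable_inv_phi_sq {z : ℂ} (hz : z ∈ offNonnegAxis) {x : ℝ} (hx : x ∈ S.dom) :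
    IntervalIntegrable (fun t => ((S.phi z t) ^ 2)⁻¹) volume 0 x := by
  have hφc : ContinuousOn (S.phi z) (Icc 0 x) := (S.isSolution_phi z).1.mono (S.Icc_subset_dom hx)
  exact ((hφc.pow 2).inv₀ (fun t ht => pow_ne_zero 2
    (S.phi_ne_zero_of_mem_offNonnegAxis hz (S.Icc_subset_dom hx ht)))).intervalIntegrable_of_Icc hx.1

/-- `∫ₓ^{x'} φ⁻² → I(x)` as `x' → L`. [folklore] -/
theorem tendsto_integral_inv_phi_sq (hS : ¬ S.IsTrivial) {z : ℂ} (hz : z ∈ offNonnegAxis) {x : ℝ}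
    (hx : x ∈ S.dom) :
    Tendsto (fun x' => ∫ t in x..x', ((S.phi z t) ^ 2)⁻¹) S.toEnd (𝓝 (S.tailInt z x)) := by
  have hq := S.tendsto_principalWeylFunction hS hz
  have hev : ∀ᶠ x' in S.toEnd, ∫ t in x..x', ((S.phi z t) ^ 2)⁻¹ =
      S.psi z x' / S.phi z x' - ∫ t in (0 : ℝ)..x, ((S.phi z t) ^ 2)⁻¹ :=
    Filter.eventually_of_mem (S.Ici_inter_dom_mem_toEnd S.zero_mem_dom) fun x' hx' => by
      rw [S.psi_div_phi_eq_integral_of_mem_offNonnegAxis hz hx'.1,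
        intervalIntegral.integral_interval_sub_left (S.intervalIntegrable_inv_phi_sq hz hx'.1)
          (S.intervalIntegrable_inv_phi_sq hz hx)]
  refine (Tendsto.congr' (EventuallyEq.symm hev) ?_)
  exact hq.sub_const _

/-- **Tail estimate** `|I(x, z)| ≤ c⁻² (T(x) + M(x))⁻¹`, where `c` is a cone constant for `z`,
`T(x) = ∫₀ˣ |φ⁺'|² dt`, `M(x) = ∫_{[0,x]} |φ|² dm > 0`. [cite: KacKrein1974, §2] -/
theorem norm_tailInt_le (hS : ¬ S.IsTrivial) {z : ℂ} (hz : z ∈ offNonnegAxis) {c : ℝ} (hc0 : 0 < c)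
    (hc : ∀ a b : ℝ, 0 ≤ a → 0 ≤ b → c * (a + b) ≤ ‖(a : ℂ) - z * b‖) {x : ℝ} (hx : x ∈ S.dom)
    (hM : 0 < ∫ u in Icc 0 x, ‖S.phi z u‖ ^ 2 ∂S.massMeasure) :
    ‖S.tailInt z x‖ ≤ (c ^ 2)⁻¹ *
      ((∫ s in (0 : ℝ)..x, ‖z * ∫ u in Icc 0 s, S.phi z u ∂S.massMeasure‖ ^ 2) +
        ∫ u in Icc 0 x, ‖S.phi z u‖ ^ 2 ∂S.massMeasure)⁻¹ := by
  haveI := S.toEnd_neBot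
  refine le_of_tendsto (S.tendsto_integral_inv_phi_sq hS hz hx).norm ?_
  refine Filter.eventually_of_mem (S.Ici_inter_dom_mem_toEnd hx) fun x' hx' => ?_
  have h := S.norm_integral_inv_phi_sq_le hz hc0 hc hx.1 le_rfl hx'.2 hx'.1 hM
  refine h.trans ?_
  have hT : 0 ≤ (∫ s in (0 : ℝ)..x', ‖z * ∫ u in Icc 0 s, S.phi z u ∂S.massMeasure‖ ^ 2) :=
    intervalIntegral.integral_nonneg (hx.1.trans hx'.2) fun s _ => by positivity
  have hpos : 0 < (∫ s in (0 : ℝ)..x', ‖z * ∫ u in Icc 0 s, S.phi z u ∂S.massMeasure‖ ^ 2) +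
      ∫ u in Icc 0 x, ‖S.phi z u‖ ^ 2 ∂S.massMeasure := by linarith
  have : 0 ≤ ((∫ s in (0 : ℝ)..x', ‖z * ∫ u in Icc 0 s, S.phi z u ∂S.massMeasure‖ ^ 2) +
      ∫ u in Icc 0 x, ‖S.phi z u‖ ^ 2 ∂S.massMeasure)⁻¹ := by positivity
  nlinarith [inv_nonneg.2 (sq_nonneg c)]

/-! ### Green's formula for the Weyl solution -/

/-- **Green's formula**: `Im z ∫_{[0,x]} |ω|² dm = Im q_S(z) - Im (ω⁺'(x) conj ω(x))`.
[cite: KacKrein1974, §2] -/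
theorem im_mul_integral_norm_weylSolution_sq (z : ℂ) {x : ℝ} (hx : x ∈ S.dom) :
    z.im * ∫ u in Icc 0 x, ‖S.weylSolution z u‖ ^ 2 ∂S.massMeasure =
      (S.principalWeylFunction z).im - (S.weylDeriv z x * conj (S.weylSolution z x)).im := by
  have h₁ := S.isSolution_weylSolution z
  have hL := h₁.lagrange h₁.conj hx
  have hR := S.integral_mul_conj_eq (x := x) (S.weylSolution z)
  have hconj : ∫ u in Icc 0 x, conj (S.weylSolution z u) ∂S.massMeasure =
      conj (∫ u in Icc 0 x, S.weylSolution z u ∂S.massMeasure) := by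
    rw [← integral_conj]
  simp only [map_neg, map_one] at hL
  rw [hR, hconj] at hL
  set w : ℂ := S.weylDeriv z x * conj (S.weylSolution z x) with hw
  set N : ℝ := ∫ u in Icc 0 x, ‖S.weylSolution z u‖ ^ 2 ∂S.massMeasure with hN
  have key : conj w - w = (-(S.principalWeylFunction z) + conj (S.principalWeylFunction z)) +
      (z - conj z) * (N : ℂ) := by
    have e1 : conj w = S.weylSolution z x *
        (-1 - conj z * conj (∫ u in Icc 0 x, S.weylSolution z u ∂S.massMeasure)) := by
      rw [hw, weylDeriv, map_mul, Complex.conj_conj]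
      simp [map_sub, map_mul, map_neg, map_one]
      ring
    have e2 : w = (-1 - z * ∫ u in Icc 0 x, S.weylSolution z u ∂S.massMeasure) *
        conj (S.weylSolution z x) := by rw [hw, weylDeriv]
    rw [e1, e2]
    linear_combination hL
  have hi := congrArg Complex.im key
  simp only [Complex.sub_im, Complex.conj_im, Complex.add_im, Complex.neg_im, Complex.mul_im,
    Complex.ofReal_re, Complex.ofReal_im, mul_zero, Complex.sub_re, Complex.conj_re,
    sub_self] at hi
  linarith

/-- The boundary term written with `φ` and `I`:
`ω⁺' conj ω = (conj φ · φ⁺') |I|² - (conj φ / φ) conj I`. [folklore] -/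
theorem boundaryTerm_eq {z : ℂ} (hz : z ∈ offNonnegAxis) {x : ℝ} (hx : x ∈ S.dom) :
    S.weylDeriv z x * conj (S.weylSolution z x) =
      conj (S.phi z x) * (-z * ∫ u in Icc 0 x, S.phi z u ∂S.massMeasure) *
          (Complex.normSq (S.tailInt z x) : ℂ) -
        conj (S.phi z x) / S.phi z x * conj (S.tailInt z x) := by
  rw [S.weylDeriv_eq hz hx, S.weylSolution_eq hz hx, map_mul, Complex.normSq_eq_conj_mul_self]
  have hφ := S.phi_ne_zero_of_mem_offNonnegAxis hz hx
  field_simp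

/-- **Bound for the boundary term**: `|ω⁺'(x) ω̄(x)| ≤ (max 1 |z| · c⁻² + 1) |I(x)|`.
[cite: KacKrein1974, §2] -/
theorem norm_boundaryTerm_le (hS : ¬ S.IsTrivial) {z : ℂ} (hz : z ∈ offNonnegAxis) {c : ℝ}
    (hc0 : 0 < c) (hc : ∀ a b : ℝ, 0 ≤ a → 0 ≤ b → c * (a + b) ≤ ‖(a : ℂ) - z * b‖) {x : ℝ}
    (hx : x ∈ S.dom) :
    ‖S.weylDeriv z x * conj (S.weylSolution z x)‖ ≤ (max 1 ‖z‖ * (c ^ 2)⁻¹ + 1) * ‖S.tailInt z x‖ := by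
  have hφ := S.phi_ne_zero_of_mem_offNonnegAxis hz hx
  rw [S.boundaryTerm_eq hz hx]
  -- abbreviations
  set T : ℝ := ∫ s in Icc 0 x, ‖z * ∫ u in Icc 0 s, S.phi z u ∂S.massMeasure‖ ^ 2 with hT
  set M : ℝ := ∫ u in Icc 0 x, ‖S.phi z u‖ ^ 2 ∂S.massMeasure with hM
  set I : ℂ := S.tailInt z x with hI
  have hT0 : 0 ≤ T := integral_nonneg fun s => by positivity
  have hM0 : 0 ≤ M := integral_nonneg fun u => by positivity
  have hTeq : (∫ s in (0 : ℝ)..x, ‖z * ∫ u in Icc 0 s, S.phi z u ∂S.massMeasure‖ ^ 2) = T := by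
    rw [intervalIntegral.integral_of_le hx.1, hT, integral_Icc_eq_integral_Ioc]
  -- the energy identity `conj φ · φ⁺' = T - z M`
  have hE := S.conj_phi_mul_deriv_eq z hx
  have h1 : ‖conj (S.phi z x) * (-z * ∫ u in Icc 0 x, S.phi z u ∂S.massMeasure)‖ ≤ T + ‖z‖ * M := by
    rw [hE]
    refine (norm_sub_le _ _).trans ?_
    rw [Complex.norm_real, Real.norm_of_nonneg hT0, norm_mul, Complex.norm_real, Real.norm_of_nonneg hM0]
  have h2 : ‖conj (S.phi z x) / S.phi z x * conj I‖ = ‖I‖ := by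
    rw [norm_mul, norm_div, Complex.norm_conj, Complex.norm_conj, div_self (norm_ne_zero_iff.2 hφ),
      one_mul]
  have hnsq : ‖(Complex.normSq I : ℂ)‖ = ‖I‖ ^ 2 := by
    rw [Complex.norm_real, Real.norm_of_nonneg (Complex.normSq_nonneg _), Complex.normSq_eq_norm_sq]
  -- `(T + |z| M) |I| ≤ max 1 |z| / c²`
  have h3 : (T + ‖z‖ * M) * ‖I‖ ≤ max 1 ‖z‖ * (c ^ 2)⁻¹ := by
    rcases eq_or_lt_of_le hM0 with hM00 | hMpos
    · -- no mass on `[0, x]`: then `T = M = 0`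
      have hμ : S.massMeasure (Icc 0 x) = 0 := by
        by_contra hne
        have := S.integral_norm_phi_sq_pos hz hx (pos_iff_ne_zero.2 hne)
        linarith
      have hT00 : T = 0 := by
        rw [hT]
        refine setIntegral_eq_zero_of_forall_eq_zero fun s hs => ?_
        have h0 : S.massMeasure (Icc 0 s) = 0 := measure_mono_null (Icc_subset_Icc_right hs.2) hμ
        have : ∫ u in Icc 0 s, S.phi z u ∂S.massMeasure = 0 := by
          rw [Measure.restrict_eq_zero.2 h0, integral_zero_measure]
        simp [this]
      rw [← hM00, hT00]
      have : 0 ≤ max 1 ‖z‖ * (c ^ 2)⁻¹ := by positivity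
      simpa using this
    · have hIle := S.norm_tailInt_le hS hz hc0 hc hx hMpos
      rw [hTeq] at hIle
      have hTM : 0 < T + M := by linarith
      calc (T + ‖z‖ * M) * ‖I‖ ≤ (max 1 ‖z‖ * (T + M)) * ((c ^ 2)⁻¹ * (T + M)⁻¹) := by
            refine mul_le_mul ?_ hIle (norm_nonneg _) (by positivity)
            have h4 : T ≤ max 1 ‖z‖ * T := le_mul_of_one_le_left hT0 (le_max_left _ _)
            have h5 : ‖z‖ * M ≤ max 1 ‖z‖ * M := mul_le_mul_of_nonneg_right (le_max_right _ _) hM0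
            linarith
        _ = max 1 ‖z‖ * (c ^ 2)⁻¹ := by field_simp
  calc ‖conj (S.phi z x) * (-z * ∫ u in Icc 0 x, S.phi z u ∂S.massMeasure) * (Complex.normSq I : ℂ) -
        conj (S.phi z x) / S.phi z x * conj I‖
      ≤ ‖conj (S.phi z x) * (-z * ∫ u in Icc 0 x, S.phi z u ∂S.massMeasure) * (Complex.normSq I : ℂ)‖ +
          ‖conj (S.phi z x) / S.phi z x * conj I‖ := norm_sub_le _ _
    _ ≤ (T + ‖z‖ * M) * ‖I‖ ^ 2 + ‖I‖ := by
        rw [norm_mul, hnsq, h2]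
        gcongr
    _ = ((T + ‖z‖ * M) * ‖I‖) * ‖I‖ + ‖I‖ := by ring
    _ ≤ (max 1 ‖z‖ * (c ^ 2)⁻¹) * ‖I‖ + ‖I‖ := by gcongr
    _ = (max 1 ‖z‖ * (c ^ 2)⁻¹ + 1) * ‖I‖ := by ring

/-- **The boundary term vanishes at `L`.** [cite: KacKrein1974, §2] -/
theorem tendsto_boundaryTerm (hS : ¬ S.IsTrivial) {z : ℂ} (hz : z ∈ offNonnegAxis) :
    Tendsto (fun x => S.weylDeriv z x * conj (S.weylSolution z x)) S.toEnd (𝓝 0) := by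
  obtain ⟨c, hc0, hc⟩ := exists_cone_constant hz
  have hI := (S.tendsto_tailInt hS hz).norm
  rw [norm_zero] at hI
  rw [tendsto_zero_iff_norm_tendsto_zero]
  refine squeeze_zero' (Filter.Eventually.of_forall fun x => norm_nonneg _) ?_
    (by simpa using hI.const_mul (max 1 ‖z‖ * (c ^ 2)⁻¹ + 1))
  exact Filter.eventually_of_mem (S.Ici_inter_dom_mem_toEnd S.zero_mem_dom) fun x hx =>
    S.norm_boundaryTerm_le hS hz hc0 hc hx.1

/-- **`Im z ∫_{[0,x]} |ω|² dm → Im q_S(z)` as `x → L`.** [cite: KacKrein1974, §2] -/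
theorem tendsto_im_mul_integral_norm_weylSolution_sq (hS : ¬ S.IsTrivial) {z : ℂ}
    (hz : z ∈ offNonnegAxis) :
    Tendsto (fun x => z.im * ∫ u in Icc 0 x, ‖S.weylSolution z u‖ ^ 2 ∂S.massMeasure) S.toEnd
      (𝓝 (S.principalWeylFunction z).im) := by
  have h := (Complex.continuous_im.tendsto 0).comp (S.tendsto_boundaryTerm hS hz)
  have h2 := (tendsto_const_nhds (x := (S.principalWeylFunction z).im)).sub h
  simp only [Function.comp_def, Complex.zero_im, sub_zero] at h2
  refine h2.congr' ?_
  exact Filter.eventually_of_mem (S.Ici_inter_dom_mem_toEnd S.zero_mem_dom) fun x hx =>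
    (S.im_mul_integral_norm_weylSolution_sq z hx.1).symm


/-! ### Exhausting `[0, L)` and the `L²(dm)` norm of the Weyl solution -/

/-- The mass measure does not charge the complement of `[0, L)`. [folklore] -/
theorem massMeasure_compl_dom : S.massMeasure S.domᶜ = 0 := by
  have hsub : S.domᶜ ⊆ Iio 0 ∪ {y : ℝ | 0 ≤ y ∧ S.length ≤ ENNReal.ofReal y} := by
    intro y hy
    by_cases h0 : 0 ≤ y
    · right
      refine ⟨h0, ?_⟩
      by_contra hlt
      exact hy ⟨h0, not_le.1 hlt⟩
    · left; exact not_le.1 h0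
  refine measure_mono_null hsub (measure_union_null S.massMeasure_Iio_zero ?_)
  by_cases hL : S.length = ⊤
  · have : {y : ℝ | 0 ≤ y ∧ S.length ≤ ENNReal.ofReal y} = ∅ := by
      ext y; simp [hL]
    rw [this, measure_empty]
  · refine measure_mono_null (fun y hy => ?_) (S.massMeasure_Ici_eq_zero S.length.toReal
      (by rw [ENNReal.ofReal_toReal hL]))
    exact (ENNReal.toReal_le_of_le_ofReal hy.1 hy.2)

/-- `[0, L)` is a measurable set. [folklore] -/
theorem measurableSet_dom : MeasurableSet S.dom := by
  have : S.dom = Ici 0 ∩ (fun y : ℝ => ENNReal.ofReal y) ⁻¹' Iio S.length := by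
    ext y; simp [mem_dom]
  rw [this]
  exact measurableSet_Ici.inter (ENNReal.measurable_ofReal measurableSet_Iio)

/-- The restriction of `dm` to `[0, L)` is `dm`. [folklore] -/
theorem restrict_dom : S.massMeasure.restrict S.dom = S.massMeasure :=
  Measure.restrict_eq_self_of_ae_mem (by
    rw [ae_iff]
    exact S.massMeasure_compl_dom)

/-- A function continuous on `[0, L)` is a.e. strongly measurable for `dm`. [folklore] -/
theorem aestronglyMeasurable_of_continuousOn {E : Type*} [TopologicalSpace E]
    [TopologicalSpace.PseudoMetrizableSpace E] {f : ℝ → E}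
    (hf : ContinuousOn f S.dom) : AEStronglyMeasurable f S.massMeasure := by
  rw [← S.restrict_dom]
  exact hf.aestronglyMeasurable S.measurableSet_dom

/-- An increasing sequence `x_n ∈ [0, L)` with `x_n → L`. [folklore] -/
def exhaust (n : ℕ) : ℝ :=
  if S.length = ⊤ then (n : ℝ) else S.length.toReal * (((n : ℝ) + 1) / ((n : ℝ) + 2))

/-- Auxiliary fact about Kreĭn strings (see the section header). [folklore] -/
theorem exhaust_mem_dom (n : ℕ) : S.exhaust n ∈ S.dom := by
  unfold exhaust
  split_ifs with hL
  · exact ⟨n.cast_nonneg, by simp [hL]⟩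
  · have hLpos : 0 < S.length.toReal := ENNReal.toReal_pos S.length_pos.ne' hL
    refine ⟨by positivity, ?_⟩
    rw [ENNReal.ofReal_lt_iff_lt_toReal (by positivity) hL]
    have : ((n : ℝ) + 1) / ((n : ℝ) + 2) < 1 := by
      rw [div_lt_one (by positivity)]; linarith
    nlinarith

/-- Auxiliary fact about Kreĭn strings (see the section header). [folklore] -/
theorem monotone_exhaust : Monotone S.exhaust := by
  intro m n hmn
  unfold exhaust
  split_ifs with hL
  · exact_mod_cast hmn
  · refine mul_le_mul_of_nonneg_left ?_ ENNReal.toReal_nonneg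
    have hmn' : (m : ℝ) ≤ n := by exact_mod_cast hmn
    rw [div_le_div_iff₀ (by positivity) (by positivity)]
    nlinarith

/-- Auxiliary fact about Kreĭn strings (see the section header). [folklore] -/
theorem tendsto_exhaust : Tendsto S.exhaust atTop S.toEnd := by
  unfold exhaust toEnd
  split_ifs with hL
  · exact tendsto_natCast_atTop_atTop
  · have hLpos : 0 < S.length.toReal := ENNReal.toReal_pos S.length_pos.ne' hL
    have h1 : Tendsto (fun n : ℕ => ((n : ℝ) + 1) / ((n : ℝ) + 2)) atTop (𝓝 1) := by
      have h : (fun n : ℕ => ((n : ℝ) + 1) / ((n : ℝ) + 2)) = fun n : ℕ => 1 - 1 / ((n : ℝ) + 2) := by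
        funext n; field_simp; ring
      rw [h]
      have h2 : Tendsto (fun n : ℕ => 1 / ((n : ℝ) + 2)) atTop (𝓝 0) := by
        have := tendsto_one_div_add_atTop_nhds_zero_nat (𝕜 := ℝ)
        have h3 : Tendsto (fun n : ℕ => n + 1) atTop atTop := tendsto_add_atTop_nat 1
        have h4 := this.comp h3
        refine h4.congr fun n => ?_
        simp only [Function.comp_apply]; push_cast; ring_nf
      simpa using (tendsto_const_nhds (x := (1 : ℝ))).sub h2
    refine tendsto_nhdsWithin_iff.2 ⟨?_, Filter.Eventually.of_forall fun n => ?_⟩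
    · simpa using h1.const_mul S.length.toReal
    · show S.length.toReal * (((n : ℝ) + 1) / ((n : ℝ) + 2)) < S.length.toReal
      have : ((n : ℝ) + 1) / ((n : ℝ) + 2) < 1 := by
        rw [div_lt_one (by positivity)]; linarith
      nlinarith

/-- Auxiliary fact about Kreĭn strings (see the section header). [folklore] -/
theorem exists_le_exhaust {x : ℝ} (hx : x ∈ S.dom) : ∃ n, x ≤ S.exhaust n := by
  have h := S.tendsto_exhaust.eventually (S.Ici_inter_dom_mem_toEnd hx)
  obtain ⟨n, hn⟩ := h.exists
  exact ⟨n, hn.2⟩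

/-- Auxiliary fact about Kreĭn strings (see the section header). [folklore] -/
theorem dom_subset_iUnion_Icc_exhaust : S.dom ⊆ ⋃ n, Icc 0 (S.exhaust n) := by
  intro x hx
  obtain ⟨n, hn⟩ := S.exists_le_exhaust hx
  exact mem_iUnion.2 ⟨n, hx.1, hn⟩

/-- Monotone exhaustion of `dm`-integrals of non-negative functions:
`∫⁻ f dm = sup_n ∫⁻_{[0, x_n]} f dm`. [folklore] -/
theorem lintegral_eq_iSup (f : ℝ → ℝ≥0∞) :
    ∫⁻ u, f u ∂S.massMeasure = ⨆ n, ∫⁻ u in Icc 0 (S.exhaust n), f u ∂S.massMeasure := by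
  have hdir : Directed (· ⊆ ·) fun n => Icc (0 : ℝ) (S.exhaust n) :=
    (monotone_nat_of_le_succ fun n => Icc_subset_Icc_right
      (S.monotone_exhaust (Nat.le_succ n))).directed_le
  rw [← setLIntegral_iUnion_of_directed f hdir]
  have hfull : S.massMeasure.restrict (⋃ n, Icc 0 (S.exhaust n)) = S.massMeasure :=
    Measure.restrict_eq_self_of_ae_mem (by
      rw [ae_iff]
      exact measure_mono_null (fun y hy => fun hd => hy (S.dom_subset_iUnion_Icc_exhaust hd))
        S.massMeasure_compl_dom)
  rw [hfull]

/-- **The `L²(dm)` norm of the Weyl solution**: for `Im z ≠ 0`,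
`∫ |ω(u, z)|² dm(u) = Im q_S(z) / Im z` (as a Lebesgue integral). [cite: KacKrein1974, §2] -/
theorem lintegral_norm_weylSolution_sq (hS : ¬ S.IsTrivial) {z : ℂ} (hz : z.im ≠ 0) :
    ∫⁻ u, ENNReal.ofReal (‖S.weylSolution z u‖ ^ 2) ∂S.massMeasure =
      ENNReal.ofReal ((S.principalWeylFunction z).im / z.im) := by
  have hzΩ : z ∈ offNonnegAxis := Or.inl hz
  -- the sequence of truncated integrals
  set a : ℕ → ℝ := fun n => ∫ u in Icc 0 (S.exhaust n), ‖S.weylSolution z u‖ ^ 2 ∂S.massMeasure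
  have hint : ∀ n, IntegrableOn (fun u => ‖S.weylSolution z u‖ ^ 2) (Icc 0 (S.exhaust n)) S.massMeasure :=
    fun n => S.integrableOn_Icc_of_continuousOn (S.exhaust_mem_dom n)
      (((S.continuousOn_weylSolution z).mono (S.Icc_subset_dom (S.exhaust_mem_dom n))).norm.pow 2)
  have ha : ∀ n, ∫⁻ u in Icc 0 (S.exhaust n), ENNReal.ofReal (‖S.weylSolution z u‖ ^ 2) ∂S.massMeasure =
      ENNReal.ofReal (a n) := fun n =>
    (ofReal_integral_eq_lintegral_ofReal (hint n) (ae_of_all _ fun u => by positivity)).symm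
  -- `a n → Im q / Im z`
  have hlim : Tendsto a atTop (𝓝 ((S.principalWeylFunction z).im / z.im)) := by
    have h := (S.tendsto_im_mul_integral_norm_weylSolution_sq hS hzΩ).comp S.tendsto_exhaust
    have h2 := h.div_const z.im
    refine h2.congr fun n => ?_
    simp only [Function.comp_apply]
    field_simp
    rfl
  have hmono : Monotone fun n => ENNReal.ofReal (a n) := by
    intro m n hmn
    show ENNReal.ofReal (a m) ≤ ENNReal.ofReal (a n)
    rw [← ha, ← ha]
    exact lintegral_mono_set (Icc_subset_Icc_right (S.monotone_exhaust hmn))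
  have hsup : Tendsto (fun n => ENNReal.ofReal (a n)) atTop (𝓝 (⨆ n, ENNReal.ofReal (a n))) :=
    tendsto_atTop_iSup hmono
  have hlim' : Tendsto (fun n => ENNReal.ofReal (a n)) atTop
      (𝓝 (ENNReal.ofReal ((S.principalWeylFunction z).im / z.im))) :=
    (ENNReal.continuous_ofReal.tendsto _).comp hlim
  rw [S.lintegral_eq_iSup]
  simp only [ha]
  exact tendsto_nhds_unique hsup hlim'

/-- **The Weyl solution is square-integrable**: `ω(·, z) ∈ L²(dm)` for `Im z ≠ 0`.
[cite: KacKrein1974, §2] -/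
theorem memLp_weylSolution (hS : ¬ S.IsTrivial) {z : ℂ} (hz : z.im ≠ 0) :
    MemLp (S.weylSolution z) 2 S.massMeasure := by
  have hmeas : AEStronglyMeasurable (S.weylSolution z) S.massMeasure :=
    S.aestronglyMeasurable_of_continuousOn (S.continuousOn_weylSolution z)
  rw [memLp_two_iff_integrable_sq_norm hmeas]
  refine ⟨hmeas.norm.pow 2, ?_⟩
  rw [hasFiniteIntegral_iff_enorm]
  have : ∫⁻ u, ‖‖S.weylSolution z u‖ ^ 2‖ₑ ∂S.massMeasure =
      ∫⁻ u, ENNReal.ofReal (‖S.weylSolution z u‖ ^ 2) ∂S.massMeasure :=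
    lintegral_congr fun u => Real.enorm_eq_ofReal (by positivity)
  rw [this, S.lintegral_norm_weylSolution_sq hS hz]
  exact ENNReal.ofReal_lt_top

/-- `∫ |ω(u,z)|² dm(u) = Im q_S(z) / Im z` as a Bochner integral (`Im z ≠ 0`). [cite: KacKrein1974, §2] -/
theorem integral_norm_weylSolution_sq (hS : ¬ S.IsTrivial) {z : ℂ} (hz : z.im ≠ 0) :
    ∫ u, ‖S.weylSolution z u‖ ^ 2 ∂S.massMeasure = (S.principalWeylFunction z).im / z.im := by
  have hnn : 0 ≤ (S.principalWeylFunction z).im / z.im := by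
    have h := S.im_principalWeylFunction_mul_im_nonneg hS (Or.inl hz)
    rcases lt_or_gt_of_ne hz with hneg | hpos
    · have : (S.principalWeylFunction z).im ≤ 0 := by nlinarith
      exact div_nonneg_of_nonpos this hneg.le
    · exact div_nonneg (nonneg_of_mul_nonneg_left h hpos) hpos.le
  have hm : AEStronglyMeasurable (fun u => ‖S.weylSolution z u‖ ^ 2) S.massMeasure :=
    (S.aestronglyMeasurable_of_continuousOn (S.continuousOn_weylSolution z)).norm.pow 2
  rw [integral_eq_lintegral_of_nonneg_ae (ae_of_all _ fun u => by positivity) hm,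
    S.lintegral_norm_weylSolution_sq hS hz, ENNReal.toReal_ofReal hnn]

end KreinString

end Literature.Analysis.InverseSpectral

end
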